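import Summits.QuantumFields.Balaban3D.Proofs.Inputs
import Summits.QuantumFields.Balaban3D.Proofs.Run3StepCumulant
import Summits.QuantumFields.Balaban3D.Proofs.Run3OldOutside

/-!
# Bałaban CMP 102 (1985), d = 3 lane — `Proofs.AlphaCumulant`: the CUMULANT / RANDOM-WALK residuals of `Proofs.Residuals` (rows C3
# `cumulant58`, C4 `cumulantLower`, C10 `oldOutside`, B21 `PprT_le`) AT THE LANE'S PIECES `Inputs.pieces 𝔎 X 𝔖 k`, REDUCED to seat
# p5's (α) inputs by APPLICATION of `Proofs.Run3StepCumulant` (`…_series_std`, v1.3) / `Proofs.Run3OldOutside` — the run slots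
# that are arithmetic of the lane's objects (`k ≤ K`, `0 < g_k ≤ 1`, `0 < M₁`, `0 < κ₀`, `0 ≤ b₀`, `r₀ ≥ 1`, `R₁ ≥ 6 + 2κ₀`, the
# normalised remainder unit, the retained radius `Rret = R₁r(g_k)` (rfl), the block count `Nblk³ ≤ |T₁^{(k)}|`
# (`Inputs.nblk_cube_le_sites`)) DISCHARGED here

Source: T. Bałaban, *Ultraviolet stability of three-dimensional lattice pure gauge field theories*, Commun. Math. Phys. **102** (1985)
255–275 [Balaban1985UV3] ([B10]; PDF page = journal page − 254): (24)–(25) p. 262, (58)–(59) p. 270, (37) p. 265, p. 272 L29–31,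
(62) p. 271 / p. 273; [Balaban1982Higgs1] (3.24) p. 616.  Lane `pub-balaban3d`, seat p3 (assembly; PLAN §0.5 E4, rulings R-DISP /
R-ACT / R-324 / R-FL / R-OMEGA; LEAF-LEDGER C3, C4, C10, B21); the leaves are seat p5's (`cumulant58_series_std`, `cumulantLower_series_std`,
`oldOutside_series_gamma` (v5: degree floor on `j ∈ Icc 1 k`), `pprT_le_series_std`; carriers frozen at p1 v1.3b).

WHAT REMAINS AS HYPOTHESES after this file (the (α) END INPUTS of rows C3/C4/C10/B21, by class; LEAF-LEDGER §F):
* [B1] (3.24) inputs (a) `h324a` (small-field volume of the box) and (c) `h324c` (cgf-derivative bound), in the smallness unit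
  `(L^kg₀²)^{3+κ₀}|T₁^{(k)}|` (= the remainder unit `rem_k`, R-NORM); the re-expansion input (b) VANISHES (R-324: the printed cumulants are
  p1's DEFINED `StepSeries.cum`);
* GAP binder G3D-02 `Binders.GraphRep23AsCited` for the data's graph carrier `(𝔖 k).Gt` (`hG`) with the ONE identification `hact` of
  its activities with the chart activities (R-ACT); (25) for the activities `h25` (a THEOREM from G3D-01 + (28): p6
  `ChartFromBound25.bound25_real_of_chart`, applied where both seats' files are imported) and for the vacuum activities `h25vac`;
* the display (44) p. 267 on the previous-scale terms `oldVal` of the data (`h44`) and their degree floor «n ≥ 2» of (43) (`hfloor`);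
* regularity of the expansion data: `hμ` (the Gaussian measure is a probability measure), `hboxm`/`hbox` (the small-field box is
  measurable of positive measure), `hVm`/`hVB` (the effective potential is a.e.-measurable and bounded on the box) — (α) data displays;
  (the former consistency hypotheses `hblocks`/`hRret`/`hΩblk` are THEOREMS at the standard tower: `Inputs.nblk_cube_le_sites`, p1
  `stdTowerInput_Rret`, `card_compl_ΩblkOf_le_ZVol`);
* the threshold `hγOO : g_k ≤ γ_OO` of row C10 (p5/p2 `Thresholds.gammaOf`);
* constants: the record's `Cz, C₁, C₁', C₆, aP` EQUAL p5's closed expressions (`hCz`, `hC₁`, `hC₁'`, `hC₆`, `haP`) and the windows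
  `κ ≥ κ₀(32,6)+1`, `0 ≤ C25`, `r₀ ≥ 1`, `R₁ ≥ 6 + 2κ₀`, signs of `κ₁, B₃, C44, Ca + Cc` — discharged where the record is DEFINED
  from the primitive constants (`Proofs.Primitives`, `Proofs.UVStability3DInputs`).
HONEST FRAMING (PLAN §0): application bookkeeping; the inputs above are hypotheses; nothing of the paper is asserted.  No `sorry`.
-/

noncomputable section

namespace Summit.QuantumFields.Balaban3D.Proofs.AlphaCumulant

open MeasureTheory
open scoped BigOperators Nat
open Literature.MathematicalPhysics.QuantumFieldTheory.Balaban1983to89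
open Literature.MathematicalPhysics.QuantumFieldTheory.Balaban1983to89.B10
open Literature.MathematicalPhysics.QuantumFieldTheory.Balaban1983to89.B10SectAGathering
open Literature.MathematicalPhysics.QuantumFieldTheory.Balaban1983to89.B10SectCExpansion (Bound44)
open Literature.MathematicalPhysics.QuantumFieldTheory.Balaban1983to89.B10Eq24Cumulant (chiMeasure truncExp)
open Literature.MathematicalPhysics.QuantumFieldTheory.Balaban1983to89.B12TreeDecay (kappa₀ K₀ K₀_pos)
open Literature.MathematicalPhysics.QuantumFieldTheory.Balaban1983to89.TreeLengthTorus (tsys tcubeSys TPt)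
open Literature.MathematicalPhysics.QuantumFieldTheory.Balaban1985CMP102
open Literature.MathematicalPhysics.QuantumFieldTheory.Balaban1985CMP102.Setting
open Literature.MathematicalPhysics.QuantumFieldTheory.Balaban1985CMP102.Binders (GraphTerms GraphRep23AsCited)
open Summit.QuantumFields.Balaban3D.Carriers
open Summit.QuantumFields.Balaban3D.Proofs.ScalesArithmetic
open Summit.QuantumFields.Balaban3D.Proofs.Constants
open Summit.QuantumFields.Balaban3D.Proofs.Inputs

variable {L : ℕ} (𝔎 : LaneConsts L) {S : Scales L} {G : Type} [GaugeGroup G] [MeasurableSpace G] [HaarData G]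
  {V : Type} [NormedAddCommGroup V] [NormedSpace ℂ V]
  (X : ExternalInputs S G) (𝔖 : ∀ k, StepSeries S G V (nblkOf S 𝔎.carrier k) k) (k : ℕ)

/-- The normalised remainder unit of the lane's pieces: `rem_k = (L^kg₀²)^{3+κ₀}|T₁^{(k)}|` (p5's `hrem`; p1 `piecesParamsOf`,
`ScalesArithmetic.norm_rem_eq`). [cite: Balaban1985UV3, p.269 L24] -/
theorem rem_pieces :
    (piecesParamsOf S 𝔎.carrier k).rem = ((L : ℝ) ^ k * S.g0sq) ^ (3 + (X.toTowerBase 𝔎.carrier).κ₀) * S.sites k :=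
  (norm_rem_eq S 𝔎.F.κ₀ k).symm

/-! ## C3 / C4 — `cumulant58`, `cumulantLower` (standard form of the expansion data, p5 v1.3) -/

open Classical in
/-- **Row C3 AT THE LANE'S PIECES** — (24) p. 262 / (58)–(59) p. 270 for `Inputs.pieces 𝔎 X 𝔖 k` with the record's `Cz`, `C₁`, from
p5's `cumulant58_series_std` (the printed cumulants are the DEFINED `(𝔖 k).cum`, R-324; the (3.24) re-expansion input (b) vanishes):
(α) inputs (3.24)(a) `h324a`, (c) `h324c` (unit `(L^kg₀²)^{3+κ₀}|T₁^{(k)}|`), G3D-02 `hG` + R-ACT `hact`, (25) `h25`; regularity `hμ`,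
`hboxm`, `hbox`, `hVm`, `hVB`; constants `hCz`, `hC₁`, `κ ≥ κ₀(32,6)+1`, `0 ≤ C25`, `0 ≤ Ca + Cc`; the slots `k ≤ K`, `0 < κ₀`, `r₀ ≥ 1`,
`R₁ ≥ 6 + 2κ₀` (record), `rem`/`Rret` (`rfl`), `Nblk³ ≤ |T₁^{(k)}|` (`Inputs.nblk_cube_le_sites`) DISCHARGED. [cite: Balaban1985UV3, (24) p.262 + (58)–(59) p.270] -/
theorem cumulant58_pieces (hk : k + 1 ≤ S.K) (hμ : IsProbabilityMeasure (𝔖 k).μ) {κ C25 : ℝ}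
    (hκ : kappa₀ (4 * 2 ^ 3) (2 * 3) + 1 ≤ κ) (hC25 : 0 ≤ C25) (hr₀ : 1 ≤ 𝔎.F.r₀) (hR₁ : 6 + 2 * 𝔎.F.κ₀ ≤ 𝔎.F.R₁)
    {C₂₃ c M₁ δ₀ : ℝ} {nbar : ℕ} {Ca Cc Bv : ℝ} (hCac : 0 ≤ Ca + Cc)
    (hCz : 𝔎.sc.Cz = C25 * K₀ (4 * 2 ^ 3) (2 * 3))
    (hC₁ : 𝔎.sc.C₁ = 0 + C25 * K₀ (4 * 2 ^ 3) (2 * 3) * Real.exp (-𝔎.F.R₁) + (Ca + 0 + Cc))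
    (hact : ∀ h Y U, ((𝔖 k).Gt h).activities.act Y U = (𝔖 k).act h Y U)
    (hboxm : ∀ h, MeasurableSet ((𝔖 k).box h)) (hbox : ∀ h, (𝔖 k).μ ((𝔖 k).box h) ≠ 0)
    (hVm : ∀ h U, AEMeasurable ((𝔖 k).𝒱 h U) (𝔖 k).μ) (hVB : ∀ h U, ∀ ω ∈ (𝔖 k).box h, |(𝔖 k).𝒱 h U ω| ≤ Bv)
    (h324a : ∀ h (U : GaugeField S.P (k + 1) G), |Real.log ((𝔖 k).μ.real ((𝔖 k).box h))| ≤
      Ca * ((L : ℝ) ^ k * S.g0sq) ^ (3 + 𝔎.F.κ₀) * S.sites k)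
    (h324c : ∀ h U, ∀ t ∈ Set.Icc (0 : ℝ) 1, |iteratedDeriv (nbar + 1) (ProbabilityTheory.cgf ((𝔖 k).𝒱 h U)
        (chiMeasure (𝔖 k).μ (((𝔖 k).box h).indicator fun _ => (1 : ℝ)))) t| ≤
          Cc * ((nbar + 1)! : ℝ) * ((L : ℝ) ^ k * S.g0sq) ^ (3 + 𝔎.F.κ₀) * S.sites k)
    (hG : ∀ h, GraphRep23AsCited ((𝔖 k).Gt h) (fun U => ∑ n ∈ Finset.Icc 1 nbar, (𝔖 k).cum h U n / (n ! : ℝ)) C₂₃ c M₁ δ₀)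
    (h25 : ∀ h, Bound25Printed ⟨(tsys 3 (𝔖 k).Nblk).Dom, GaugeField S.P (k + 1) G, (tsys 3 (𝔖 k).Nblk).dj, (𝔖 k).act h⟩
      (S.gk k) κ C25) :
    Cumulant58 (pieces 𝔎 X 𝔖 k) 𝔎.sc.Cz 𝔎.sc.C₁ := by
  haveI := hμ
  rw [hCz, hC₁]
  exact cumulant58_series_std (X.toTowerBase 𝔎.carrier) 𝔖 (piecesParamsOf S 𝔎.carrier) k hκ hC25 hact hboxm hbox hVm hVB h324a
    h324c hCac (by omega) 𝔎.F.κ₀_pos hr₀ hR₁ (rem_pieces 𝔎 X k) rfl (nblk_cube_le_sites 𝔎 k (by omega)) hG h25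

open Classical in
/-- **Row C4 AT THE LANE'S PIECES** — the lower cumulant direction at the trivial history ((37) p. 265 / p. 272 / (59) p. 270) with the
record's `C₁'`, from p5's `cumulantLower_series_std`; same inputs as `cumulant58_pieces` with `hC₁'` in place of `hCz`/`hC₁`.
[cite: Balaban1985UV3, (37) p.265 + p.272 + (59) p.270] -/
theorem cumulantLower_pieces (hk : k + 1 ≤ S.K) (hμ : IsProbabilityMeasure (𝔖 k).μ) {κ C25 : ℝ}
    (hκ : kappa₀ (4 * 2 ^ 3) (2 * 3) + 1 ≤ κ) (hC25 : 0 ≤ C25) (hr₀ : 1 ≤ 𝔎.F.r₀) (hR₁ : 6 + 2 * 𝔎.F.κ₀ ≤ 𝔎.F.R₁)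
    {C₂₃ c M₁ δ₀ : ℝ} {nbar : ℕ} {Ca Cc Bv : ℝ} (hCac : 0 ≤ Ca + Cc)
    (hC₁' : 𝔎.sc.C₁' = 0 + C25 * K₀ (4 * 2 ^ 3) (2 * 3) * Real.exp (-𝔎.F.R₁) + (Ca + 0 + Cc))
    (hact : ∀ h Y U, ((𝔖 k).Gt h).activities.act Y U = (𝔖 k).act h Y U)
    (hboxm : ∀ h, MeasurableSet ((𝔖 k).box h)) (hbox : ∀ h, (𝔖 k).μ ((𝔖 k).box h) ≠ 0)
    (hVm : ∀ h U, AEMeasurable ((𝔖 k).𝒱 h U) (𝔖 k).μ) (hVB : ∀ h U, ∀ ω ∈ (𝔖 k).box h, |(𝔖 k).𝒱 h U ω| ≤ Bv)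
    (h324a : ∀ h (U : GaugeField S.P (k + 1) G), |Real.log ((𝔖 k).μ.real ((𝔖 k).box h))| ≤
      Ca * ((L : ℝ) ^ k * S.g0sq) ^ (3 + 𝔎.F.κ₀) * S.sites k)
    (h324c : ∀ h U, ∀ t ∈ Set.Icc (0 : ℝ) 1, |iteratedDeriv (nbar + 1) (ProbabilityTheory.cgf ((𝔖 k).𝒱 h U)
        (chiMeasure (𝔖 k).μ (((𝔖 k).box h).indicator fun _ => (1 : ℝ)))) t| ≤
          Cc * ((nbar + 1)! : ℝ) * ((L : ℝ) ^ k * S.g0sq) ^ (3 + 𝔎.F.κ₀) * S.sites k)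
    (hG : ∀ h, GraphRep23AsCited ((𝔖 k).Gt h) (fun U => ∑ n ∈ Finset.Icc 1 nbar, (𝔖 k).cum h U n / (n ! : ℝ)) C₂₃ c M₁ δ₀)
    (h25 : ∀ h, Bound25Printed ⟨(tsys 3 (𝔖 k).Nblk).Dom, GaugeField S.P (k + 1) G, (tsys 3 (𝔖 k).Nblk).dj, (𝔖 k).act h⟩
      (S.gk k) κ C25) :
    CumulantLower (pieces 𝔎 X 𝔖 k) 𝔎.sc.C₁' := by
  haveI := hμ
  rw [hC₁']
  exact cumulantLower_series_std (X.toTowerBase 𝔎.carrier) 𝔖 (piecesParamsOf S 𝔎.carrier) k hκ hC25 hact hboxm hbox hVm hVB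
    h324a h324c hCac (by omega) 𝔎.F.κ₀_pos hr₀ hR₁ (rem_pieces 𝔎 X k) rfl (nblk_cube_le_sites 𝔎 k (by omega)) hG h25

/-! ## B21 — `PprT_le` -/

open Classical in
/-- **Row B21 AT THE LANE'S PIECES** — `|Σ_X 𝒫′_{k+1}(g_k, X, 1)| ≤ aP|T₁^{(k)}|` (p. 273, from (25)) for `Inputs.pieces 𝔎 X 𝔖 k` with the
record's `aP`, from p5's `pprT_le_series_std`: (α) input (25) for the vacuum activities `Re Ψ_X(0)` (`h25vac`; = G3D-01 at the chart
centre); constants `haP : aP = C25·K₀(32,6)`, `κ ≥ κ₀(32,6)`, `0 ≤ C25`; the slots `k ≤ K`, `Nblk³ ≤ |T₁^{(k)}|` DISCHARGED —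
literally the `RunResiduals.PprT_le` field at step `k`. [cite: Balaban1985UV3, (62) p.271 + p.273] -/
theorem pprT_le_pieces (hk : k + 1 ≤ S.K) {κ C25 : ℝ} (hκ : kappa₀ (4 * 2 ^ 3) (2 * 3) ≤ κ) (hC25 : 0 ≤ C25)
    (haP : 𝔎.F.aP = C25 * K₀ (4 * 2 ^ 3) (2 * 3))
    (h25vac : Bound25Printed
      ⟨(tsys 3 (𝔖 k).Nblk).Dom, GaugeField S.P (k + 1) G, (tsys 3 (𝔖 k).Nblk).dj, fun Y _ => ((𝔖 k).Ψ Y 0).re⟩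
        (S.gk k) κ C25) :
    |(pieces 𝔎 X 𝔖 k).PprT| ≤ 𝔎.F.aP * S.sites k := by
  rw [haP]
  exact pprT_le_series_std (X.toTowerBase 𝔎.carrier) 𝔖 (piecesParamsOf S 𝔎.carrier) k hκ hC25 (by omega) (fun _ => 1) h25vac
    (nblk_cube_le_sites 𝔎 k (by omega))

/-! ## C10 — `oldOutside` -/

/-- **Row C10 AT THE LANE'S PIECES** — p. 272 L29–31 «we estimate a sum of all terms 𝒫_j(Y_j, U_{k+1}) with localizations Y_j not
contained in Ω_{k+1} … by O(1)|Z_k|» for `Inputs.pieces 𝔎 X 𝔖 k` with the record's `C₆`, from p5's `oldOutside_series` (all scales,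
k-uniform constant): (α) inputs = the display (44) p. 267 on the previous-scale terms `oldVal` of the data at every old scale
`1 ≤ j ≤ k` (`h44`), the degree floor «n ≥ 2» of (43) (`hfloor`), and the threshold `hγOO : g_k ≤ γ_OO` (p5's `γ_OO := gammaOf b₀ p₀
(1/(2·8L²B₃Z′))`, seat p2's `Thresholds.gammaOf`; discharged where `γ₀` is fixed); constants `hC₆`, `0 ≤ C44`, `0 ≤ B₃`, `0 < κ₁`; the
slots `0 < M₁`, `0 < b₀`, `0 < p₀`, `0 < g_k ≤ 1`, `k + 1 ≤ m + K` DISCHARGED (p5 `oldOutside_series_gamma`). [cite: Balaban1985UV3, p.272 L29–31 + (44) p.267] -/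
theorem oldOutside_pieces (hk : k + 1 ≤ S.K) {κ₁ B₃ C44 : ℝ} (hC : 0 ≤ C44) (hB : 0 ≤ B₃) (hκ₁ : 0 < κ₁)
    (hC₆ : 𝔎.sc.C₆ = C44 / 2 * (8 * (𝔎.F.M₁ : ℝ) ^ 6)
      * (48 / (κ₁ / 2) ^ 3 * Real.exp (κ₁ / 2 / 2) / (1 - Real.exp (-(κ₁ / 2 / 2)))) * (𝔎.F.M₁ : ℝ)⁻¹ ^ 3 * ((L : ℝ) / ((L : ℝ) - 1)))
    (h44 : ∀ (h : Hist S.P (k + 1)) (U : GaugeField S.P (k + 1) G), ∀ j ∈ Finset.Icc 1 k,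
      Bound44 (oldGeom S.P k j) (fun y n c => (𝔖 k).oldVal h U j y n c) κ₁ (𝔎.F.M₁ : ℝ) (ell S.P k j) (L : ℝ) B₃
        (S.gk k) (pFun 𝔎.F.b₀ 𝔎.F.p₀ (S.gk k)) C44)
    (hfloor : ∀ (h : Hist S.P (k + 1)) (U : GaugeField S.P (k + 1) G), ∀ j ∈ Finset.Icc 1 k,
      ∀ (y : Site S.P j) (n : ℕ) (c : Fin n → PBond S.P j), (𝔖 k).oldVal h U j y n c ≠ 0 → 2 ≤ n)
    (hγOO : S.gk k ≤ Thresholds.gammaOf 𝔎.F.b₀ 𝔎.F.p₀ (1 / (2 * (8 * (L : ℝ) ^ 2 * B₃ *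
        (2 / (κ₁ / (2 * 𝔎.F.M₁)) * (24 * (48 / (κ₁ / (2 * 𝔎.F.M₁) / 2) ^ 3 * Real.exp (κ₁ / (2 * 𝔎.F.M₁) / 2 / 2) /
          (1 - Real.exp (-(κ₁ / (2 * 𝔎.F.M₁) / 2 / 2)))) * 1)))))) :
    OldOutside (pieces 𝔎 X 𝔖 k) 𝔎.sc.C₆ := by
  rw [hC₆]
  exact oldOutside_series_gamma (X.toTowerBase 𝔎.carrier) 𝔖 (piecesParamsOf S 𝔎.carrier) k
    (by show k + 1 ≤ S.m + S.K; omega) hC hB hκ₁ 𝔎.F.M₁_pos 𝔎.F.b₀_pos 𝔎.F.p₀_pos (gk_pos S k)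
    (gk_le_one S S.gK_le_one k (by omega)) h44 hfloor hγOO

end Summit.QuantumFields.Balaban3D.Proofs.AlphaCumulant

end
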